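import Mathlib
import HarnessLib
import Summits.Ventures.LatticeQCDFlow.Exactness.CabibboMarinariErgodic
import Summits.Ventures.LatticeQCDFlow.Exactness.WilsonHeatBathErgodic

/-!
# The SU(N) Cabibbo–Marinari heat-bath SWEEP over the lattice is uniformly ergodic and converges to the Wilson measure

HONEST FRAMING: exact (Metropolis-corrected) sampling algorithms for lattice gauge theory;
figures of merit are autocorrelation/cost numbers at stated couplings and volumes; no
continuum-physics claim.

Venture `LatticeQCDFlow` (cell pub-lqcd), topic `Exactness`, FANOUT row 9 (eng-latcore, the
engine `latflow.core`: `lc_sweep` / `update_link` in `csrc/latcore_template.c` — for every link,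
one Cabibbo–Marinari heat-bath hit per coordinate pair `(i, j)`, `i < j`, lexicographically).  NEW
WORK of the cell over Mathlib, row 9's gen-6…9 files (`SubgroupHeatBath.lean`, `RefreshScan.lean`,
`HeatBathSweepErgodic.lean`, `HeatBathSweepCompact.lean`, `DoeblinUniqueness.lean`,
`WilsonHeatBathErgodic.lean`) and this generation's chain ending in `CabibboMarinariErgodic.lean`;
nothing is cited as a fact.  Printed counterparts, NAMED ONLY: Cabibbo–Marinari 1982;
Meyn–Tweedie 1993 Thm 16.0.2.  THIS CLOSES the item "SU(N ≥ 3) Cabibbo–Marinari ergodicity" listed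
as NOT CLAIMED in `HeatBathSweepErgodic.lean`, `CabibboMarinariKernel.lean`, `CabibboMarinariSweep.lean`.

## What is proved (`n` finite nonempty linearly ordered, `ι` a finite type of links, `Cfg ι n = ι → SU(N)`)

* §1 `linkHom l` (`g ↦ (1,…,g,…,1)`, `linkHom_mul`: left multiplication by it multiplies link `l`
  by `g`), `latFrameHom l e`; **`latHit p l e`** — the lattice Cabibbo–Marinari hit (the subgroup
  heat bath of `SubgroupHeatBath.lean` on the product group, weight = the joint density `p`);
  `latLink`, **`latSweep`**; `isMarkovKernel_latHit`, **`latHit_invariant`** (exact for `p · ⊗Haar`),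
  **`smul_kick_le_latHit`** (each hit dominates `(m/M) ×` its Haar kick).
* §2 `listConv_map_monoidHom`, `map_linkHom_mul_eq_refresh`; **`latLink_minorised`** — the link
  update dominates `ε ×` the free Haar refresh of its link (`RefreshScan.refresh`) from every
  configuration, via `smul_haar_le_listConv_pairs` pushed along `linkHom l`;
  **`latSweep_minorised`** (DOEBLIN for the sweep: `≥ ε' × ⊗Haar`, `cycle_refresh_eq_const`);
  `latSweep_invariant_piGibbsLaw`; **`latSweep_uniformlyErgodic`** (`|μ₀Kᵗ(A) − π(A)| ≤ (1 − ε)ᵗ`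
  for every initial law, `t`, `A`; `0 < m ≤ p ≤ M < ∞`); **`latSweep_invariant_unique`**.
* §3 `latSweep_uniformlyErgodic_of_continuous` (continuous action, bounds by compactness).
* §4 **`wilson_cmSweep_uniformlyErgodic`** — for the Literature torus Wilson theory with gauge
  group `SU(N)` and any continuous representation, coupling, dimension and size: the sweep of
  Cabibbo–Marinari link updates (all pairs, forward or reversed scan, every edge visited) converges
  setwise and geometrically to `wilsonMeasure ρ β` from every start.

NOT CLAIMED: any useful rate (the constant is qualitative); the interleaved over-relaxation sweeps
(exact — `CabibboMarinariOverrelax.lean` — and absorbed by `minorised_comp_left` exactly as in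
`heatBathSweep_comp_uniformlyErgodic`, not restated); HMC.
-/

namespace Summit.Ventures.LatticeQCDFlow.Exactness

open Matrix MeasureTheory WithLp Metric Complex ProbabilityTheory Measure Set
open scoped ENNReal

variable {n : Type*} [Fintype n] [DecidableEq n]

/-! ## §1 The lattice configuration group and the Cabibbo–Marinari hit of one link in one subgroup -/

section Lattice

variable {ι : Type*} [Fintype ι] [DecidableEq ι] {m : Type*} [Fintype m] [DecidableEq m]

/-- The configuration space `SU(N)^{links}` (a compact product group). -/
abbrev Cfg (ι : Type*) (n : Type*) [Fintype n] [DecidableEq n] := ι → Matrix.specialUnitaryGroup n ℂ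

/-- Reference law: Haar on every link. -/
noncomputable abbrev linkHaar (ι : Type*) (n : Type*) [Fintype n] [DecidableEq n] :
    ι → Measure (Matrix.specialUnitaryGroup n ℂ) :=
  fun _ => Literature.MathematicalPhysics.QuantumFieldTheory.haarProbability (Matrix.specialUnitaryGroup n ℂ)

/-- The embedding of link `l`: `g ↦ (1, …, g, …, 1)`. -/
def linkHom (l : ι) : Matrix.specialUnitaryGroup n ℂ →* Cfg ι n :=
  MonoidHom.mulSingle (fun _ : ι => Matrix.specialUnitaryGroup n ℂ) l

omit [Fintype ι] in
/-- Pointwise: `linkHom l g = Pi.mulSingle l g`. -/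
theorem linkHom_apply (l : ι) (g : Matrix.specialUnitaryGroup n ℂ) : linkHom l g = Pi.mulSingle l g := rfl

omit [Fintype ι] in
/-- It is measurable. -/
theorem measurable_linkHom (l : ι) : Measurable (linkHom (n := n) l) := by
  refine measurable_pi_lambda _ fun j => ?_
  by_cases hj : j = l
  · subst hj
    simp only [linkHom_apply, Pi.mulSingle_eq_same]
    exact measurable_id
  · simp only [linkHom_apply, Pi.mulSingle_eq_of_ne hj]
    exact measurable_const

omit [Fintype ι] in
/-- **Left multiplication by `linkHom l g` multiplies link `l` by `g` on the left and fixes the rest.** -/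
theorem linkHom_mul (l : ι) (g : Matrix.specialUnitaryGroup n ℂ) (ω : Cfg ι n) :
    linkHom l g * ω = Function.update ω l (g * ω l) := by
  funext j
  rw [Pi.mul_apply, linkHom_apply]
  by_cases hj : j = l
  · subst hj; simp
  · simp [hj]

/-- The SU(2) subgroup of the frame `e` at link `l`, as a homomorphism into the configuration group. -/
def latFrameHom (l : ι) (e : n ≃ Fin 2 ⊕ m) : Matrix.specialUnitaryGroup (Fin 2) ℂ →* Cfg ι n :=
  (linkHom l).comp (blockEmbSU e)

omit [Fintype ι] in
/-- It is measurable. -/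
theorem measurable_latFrameHom (l : ι) (e : n ≃ Fin 2 ⊕ m) : Measurable (latFrameHom (n := n) l e) :=
  (measurable_linkHom l).comp (measurable_blockEmbSU e)

/-- **The lattice Cabibbo–Marinari hit** at link `l` in the subgroup frame `e` for the joint density
`p`: left-multiply link `l` by `φ_e(h)`, `h ∈ SU(2)` drawn with density `∝ p(new configuration)`
against Haar of SU(2) (`SubgroupHeatBath.subgroupHaarHeatBath` on the product group; for
`p = e^{−β S_W}` only the plaquettes through `l` matter, `HeatBathLocality.lean`). -/
noncomputable def latHit (p : Cfg ι n → ℝ≥0∞) (l : ι) (e : n ≃ Fin 2 ⊕ m) : Kernel (Cfg ι n) (Cfg ι n) :=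
  subgroupHaarHeatBath haarSU2 (latFrameHom l e) (measurable_latFrameHom l e) p

/-- The link update: the cycle of hits over the subgroup frames. -/
noncomputable def latLink (p : Cfg ι n → ℝ≥0∞) (frames : List (n ≃ Fin 2 ⊕ m)) (l : ι) : Kernel (Cfg ι n) (Cfg ι n) :=
  cycle (frames.map (latHit p l))

/-- **The lattice sweep**: the cycle of link updates over a list of links. -/
noncomputable def latSweep (p : Cfg ι n → ℝ≥0∞) (frames : List (n ≃ Fin 2 ⊕ m)) (links : List ι) :
    Kernel (Cfg ι n) (Cfg ι n) :=
  cycle (links.map (latLink p frames))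

variable {p : Cfg ι n → ℝ≥0∞} {mlo Mhi : ℝ≥0∞}

omit [Fintype ι] in
/-- The normaliser of a hit lies in `[m, M]` under `m ≤ p ≤ M`. -/
theorem latHit_norm_bounds (hmp : ∀ ω, mlo ≤ p ω) (hpM : ∀ ω, p ω ≤ Mhi) (l : ι) (e : n ≃ Fin 2 ⊕ m) (ω : Cfg ι n) :
    mlo ≤ subgroupNorm haarSU2 (latFrameHom l e) p ω ∧ subgroupNorm haarSU2 (latFrameHom l e) p ω ≤ Mhi := by
  unfold subgroupNorm
  constructor
  · calc mlo = ∫⁻ _, mlo ∂haarSU2 := by rw [lintegral_const, measure_univ, mul_one]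
      _ ≤ _ := lintegral_mono fun h => hmp _
  · calc ∫⁻ h, p (latFrameHom l e h * ω) ∂haarSU2 ≤ ∫⁻ _, Mhi ∂haarSU2 := lintegral_mono fun h => hpM _
      _ = Mhi := by rw [lintegral_const, measure_univ, mul_one]

omit [Fintype ι] in
/-- Each hit is a Markov kernel (`0 < m`, `M < ∞`). -/
theorem isMarkovKernel_latHit (hp : Measurable p) (hm0 : mlo ≠ 0) (hMtop : Mhi ≠ ∞) (hmp : ∀ ω, mlo ≤ p ω)
    (hpM : ∀ ω, p ω ≤ Mhi) (l : ι) (e : n ≃ Fin 2 ⊕ m) : IsMarkovKernel (latHit p l e) :=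
  isMarkovKernel_subgroupHaarHeatBath _ _ _ hp
    (fun ω => (lt_of_lt_of_le (pos_iff_ne_zero.2 hm0) (latHit_norm_bounds hmp hpM l e ω).1).ne')
    (fun ω => ne_top_of_le_ne_top hMtop (latHit_norm_bounds hmp hpM l e ω).2)

/-- **Each hit is exact**: it leaves `p · ⊗Haar` invariant. -/
theorem latHit_invariant (hp : Measurable p) (hm0 : mlo ≠ 0) (hMtop : Mhi ≠ ∞) (hmp : ∀ ω, mlo ≤ p ω)
    (hpM : ∀ ω, p ω ≤ Mhi) (l : ι) (e : n ≃ Fin 2 ⊕ m) :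
    Kernel.Invariant (latHit p l e) ((Measure.pi (linkHaar ι n)).withDensity p) :=
  subgroupHaarHeatBath_invariant _ _ _ _ hp
    (fun ω => (lt_of_lt_of_le (pos_iff_ne_zero.2 hm0) (latHit_norm_bounds hmp hpM l e ω).1).ne')
    (fun ω => ne_top_of_le_ne_top hMtop (latHit_norm_bounds hmp hpM l e ω).2)

omit [Fintype ι] in
/-- **Each hit dominates `(m/M) ×` the Haar kick of its subgroup.** -/
theorem smul_kick_le_latHit (hp : Measurable p) (hMtop : Mhi ≠ ∞) (hmp : ∀ ω, mlo ≤ p ω)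
    (hpM : ∀ ω, p ω ≤ Mhi) (l : ι) (e : n ≃ Fin 2 ⊕ m) (ω : Cfg ι n) :
    (mlo * Mhi⁻¹) • haarSU2.map (fun h => latFrameHom l e h * ω) ≤ latHit p l e ω := by
  by_cases hM0 : Mhi = 0
  · have : mlo = 0 := le_antisymm (le_trans (hmp ω) (hM0 ▸ hpM ω)) zero_le
    rw [this, zero_mul, zero_smul]; exact Measure.zero_le _
  refine Measure.le_iff.2 fun B hB => ?_
  rw [Measure.smul_apply, smul_eq_mul, latHit, subgroupHaarHeatBath_apply _ _ (measurable_latFrameHom l e) hp ω hB,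
    Measure.map_apply ((measurable_latFrameHom l e).mul_const ω) hB,
    ← lintegral_indicator_one (((measurable_latFrameHom l e).mul_const ω) hB),
    ← lintegral_const_mul' _ _ (ENNReal.mul_ne_top (ne_top_of_le_ne_top hMtop ((hmp ω).trans (hpM ω)))
      (ENNReal.inv_ne_top.2 hM0))]
  refine lintegral_mono fun h => ?_
  by_cases hmem : latFrameHom l e h * ω ∈ B
  · rw [Set.indicator_of_mem (show h ∈ (fun h => latFrameHom l e h * ω) ⁻¹' B from hmem), Pi.one_apply, mul_one,
      Set.indicator_of_mem hmem, Pi.one_apply, one_mul]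
    exact mul_le_mul' (hmp _) (ENNReal.inv_le_inv.2 (latHit_norm_bounds hmp hpM l e ω).2)
  · rw [Set.indicator_of_notMem (show h ∉ (fun h => latFrameHom l e h * ω) ⁻¹' B from hmem), mul_zero]
    exact zero_le

/-! ## §2 Doeblin for the link update and the sweep -/

/-- A list convolution is pushed forward factorwise by a measurable homomorphism. -/
theorem listConv_map_monoidHom {G G' : Type*} [Group G] [MeasurableSpace G] [MeasurableMul₂ G]
    [Group G'] [MeasurableSpace G'] [MeasurableMul₂ G'] (L : G →* G') (hL : Measurable L) :
    ∀ (l : List (Measure G)), (∀ μ ∈ l, IsProbabilityMeasure μ) →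
      (listConv l).map L = listConv (l.map fun μ => μ.map L)
  | [], _ => by rw [listConv_nil, Measure.map_dirac' hL, map_one, List.map_nil, listConv_nil]
  | μ :: l, h => by
      haveI := h μ (by simp)
      haveI := isProbabilityMeasure_listConv l fun ν hν => h ν (by simp [hν])
      rw [listConv_cons, Measure.map_mconv_monoidHom L hL, listConv_map_monoidHom L hL l fun ν hν => h ν (by simp [hν]),
        List.map_cons, listConv_cons]

omit [Fintype ι] in
/-- The free Haar refresh of link `l`, written as a push-forward of the link-`l` Haar kick. -/
theorem map_linkHom_mul_eq_refresh (l : ι) (ω : Cfg ι n) :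
    ((Literature.MathematicalPhysics.QuantumFieldTheory.haarProbability (Matrix.specialUnitaryGroup n ℂ)).map
        (linkHom l)).map (fun x => x * ω) = refresh (linkHaar ι n) l ω := by
  rw [refresh, siteLift_apply, Kernel.const_apply, Measure.map_map (measurable_mul_const ω) (measurable_linkHom l)]
  have hfun : (fun x => x * ω) ∘ (linkHom (n := n) l) =
      Function.update ω l ∘ (fun g : Matrix.specialUnitaryGroup n ℂ => g * ω l) := by
    funext g; exact linkHom_mul l g ω
  rw [hfun, ← Measure.map_map (measurable_update ω) (measurable_mul_const (ω l)), map_mul_right_eq_self]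

variable [Nonempty n] [LinearOrder n]

omit [Fintype ι] in
/-- **The link update dominates `ε ×` the free Haar refresh of its link**, from every configuration,
for frames running through the lexicographic pairs or their reverse (`0 < m ≤ p ≤ M < ∞`). -/
theorem latLink_minorised (hp : Measurable p) (hm0 : mlo ≠ 0) (hMtop : Mhi ≠ ∞) (hmp : ∀ ω, mlo ≤ p ω)
    (hpM : ∀ ω, p ω ≤ Mhi) (frames : List (n ≃ Fin 2 ⊕ m))
    (hlex : frames.map pairOf = lexPairs (Finset.univ.sort (· ≤ ·) : List n) ∨
      frames.map pairOf = (lexPairs (Finset.univ.sort (· ≤ ·) : List n)).reverse) :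
    ∃ ε : ℝ≥0∞, ε ≠ 0 ∧ ∀ (l : ι) (ω : Cfg ι n), ε • refresh (linkHaar ι n) l ω ≤ latLink p frames l ω := by
  obtain ⟨c₀, hc₀, hhaar⟩ := smul_haar_le_listConv_pairs (n := n) (ps := frames.map pairOf) hlex
  have hMinv : Mhi⁻¹ ≠ 0 := ENNReal.inv_ne_zero.2 hMtop
  refine ⟨(mlo * Mhi⁻¹) ^ frames.length * c₀, mul_ne_zero (pow_ne_zero _ (mul_ne_zero hm0 hMinv)) hc₀,
    fun l ω => ?_⟩
  have h2 : List.Forall₂ (fun κ Φ => ∀ a, (mlo * Mhi⁻¹) • Φ a ≤ κ a) (frames.map (latHit p l))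
      (frames.map fun e => subgroupMove haarSU2 (latFrameHom l e) (measurable_latFrameHom l e)) :=
    List.forall₂_map_left_iff.2 (List.forall₂_map_right_iff.2 (List.forall₂_same.2 fun e _ a => by
      rw [subgroupMove_apply]
      exact smul_kick_le_latHit hp hMtop hmp hpM l e a))
  have hcyc := cycle_minorised h2 ω
  rw [List.length_map, cycle_kicks_apply (latFrameHom (n := n) l) (measurable_latFrameHom l) ω frames] at hcyc
  -- the kick laws on the lattice are the SU(N) kick laws pushed along `linkHom l`
  have hlaws : (frames.map fun e => haarSU2.map (latFrameHom (n := n) l e)) =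
      (frames.map fun e => haarSU2.map (blockEmbSU e)).map
        (fun μ : Measure (Matrix.specialUnitaryGroup n ℂ) => μ.map (linkHom (n := n) l)) := by
    rw [List.map_map]
    refine List.map_congr_left fun e _ => ?_
    change haarSU2.map ((linkHom l) ∘ (blockEmbSU e)) = ((fun μ => Measure.map (linkHom l) μ) ∘ _) e
    rw [Function.comp_apply, Measure.map_map (measurable_linkHom l) (measurable_blockEmbSU e)]
  have hSU : (frames.map fun e => haarSU2.map (blockEmbSU e)) = (frames.map pairOf).map fun q => pairLaw' q.1 q.2 := by
    rw [List.map_map]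
    exact List.map_congr_left fun e _ => map_blockEmbSU_eq_pairLaw' e
  rw [hlaws, ← listConv_map_monoidHom (linkHom l) (measurable_linkHom l) _ (fun μ hμ => by
      obtain ⟨e, -, rfl⟩ := List.mem_map.1 hμ
      exact Measure.isProbabilityMeasure_map (measurable_blockEmbSU e).aemeasurable), hSU] at hcyc
  -- compare with the refresh
  have h3 := Measure.map_mono (Measure.map_mono hhaar (measurable_linkHom (n := n) l)) (measurable_mul_const ω)
  rw [Measure.map_smul, Measure.map_smul, map_linkHom_mul_eq_refresh] at h3
  calc ((mlo * Mhi⁻¹) ^ frames.length * c₀) • refresh (linkHaar ι n) l ω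
      = (mlo * Mhi⁻¹) ^ frames.length • (c₀ • refresh (linkHaar ι n) l ω) := by rw [smul_smul]
    _ ≤ (mlo * Mhi⁻¹) ^ frames.length •
        ((listConv ((frames.map pairOf).map fun q => pairLaw' q.1 q.2)).map (linkHom l)).map (fun x => x * ω) :=
          measure_smul_le_smul_of_le h3 _
    _ ≤ latLink p frames l ω := hcyc

/-- **DOEBLIN for the lattice sweep**: a sweep of link updates over a list containing every link
dominates `ε' ×` the product Haar law from EVERY configuration. -/
theorem latSweep_minorised (hp : Measurable p) (hm0 : mlo ≠ 0) (hMtop : Mhi ≠ ∞) (hmp : ∀ ω, mlo ≤ p ω)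
    (hpM : ∀ ω, p ω ≤ Mhi) (frames : List (n ≃ Fin 2 ⊕ m))
    (hlex : frames.map pairOf = lexPairs (Finset.univ.sort (· ≤ ·) : List n) ∨
      frames.map pairOf = (lexPairs (Finset.univ.sort (· ≤ ·) : List n)).reverse)
    {links : List ι} (hl : ∀ l, l ∈ links) :
    ∃ ε : ℝ≥0∞, ε ≠ 0 ∧ ∀ ω : Cfg ι n, ε • Measure.pi (linkHaar ι n) ≤ latSweep p frames links ω := by
  obtain ⟨ε, hε, hlink⟩ := latLink_minorised hp hm0 hMtop hmp hpM frames hlex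
  refine ⟨ε ^ links.length, pow_ne_zero _ hε, fun ω => ?_⟩
  have h2 : List.Forall₂ (fun κ Φ => ∀ a, ε • Φ a ≤ κ a) (links.map (latLink p frames))
      (links.map (refresh (linkHaar ι n))) :=
    List.forall₂_map_left_iff.2 (List.forall₂_map_right_iff.2 (List.forall₂_same.2 fun l _ a => hlink l a))
  have h := cycle_minorised h2 ω
  rwa [List.length_map, cycle_refresh_eq_const hl, Kernel.const_apply] at h

omit [Fintype ι] [Nonempty n] [LinearOrder n] in
/-- The sweep is a Markov kernel. -/
theorem isMarkovKernel_latSweep (hp : Measurable p) (hm0 : mlo ≠ 0) (hMtop : Mhi ≠ ∞) (hmp : ∀ ω, mlo ≤ p ω)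
    (hpM : ∀ ω, p ω ≤ Mhi) (frames : List (n ≃ Fin 2 ⊕ m)) (links : List ι) :
    IsMarkovKernel (latSweep p frames links) := by
  refine isMarkovKernel_cycle fun κ hκ => ?_
  obtain ⟨l, -, rfl⟩ := List.mem_map.1 hκ
  refine isMarkovKernel_cycle fun κ' hκ' => ?_
  obtain ⟨e, -, rfl⟩ := List.mem_map.1 hκ'
  exact isMarkovKernel_latHit hp hm0 hMtop hmp hpM l e

omit [Nonempty n] [LinearOrder n] in
/-- **The sweep is exact**: the Gibbs law is invariant. -/
theorem latSweep_invariant_piGibbsLaw (hp : Measurable p) (hm0 : mlo ≠ 0) (hMtop : Mhi ≠ ∞)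
    (hmp : ∀ ω, mlo ≤ p ω) (hpM : ∀ ω, p ω ≤ Mhi) (frames : List (n ≃ Fin 2 ⊕ m)) (links : List ι) :
    Kernel.Invariant (latSweep p frames links) (piGibbsLaw (linkHaar ι n) p) := by
  refine invariant_smul (invariant_cycle fun κ hκ => ?_) _
  obtain ⟨l, -, rfl⟩ := List.mem_map.1 hκ
  refine invariant_cycle fun κ' hκ' => ?_
  obtain ⟨e, -, rfl⟩ := List.mem_map.1 hκ'
  exact latHit_invariant hp hm0 hMtop hmp hpM l e

/-- **The SU(N) Cabibbo–Marinari heat-bath SWEEP is uniformly ergodic.**  On a finite lattice of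
links with a measurable joint density `0 < m ≤ p ≤ M < ∞` against product Haar: for frames running
through all coordinate pairs (lexicographic or reversed) and any list of links containing every link,
there is `ε > 0` with `|μ₀Kᵗ(A) − π(A)| ≤ (1 − ε)ᵗ` for EVERY initial law `μ₀`, every `t`, every set
`A` (`π = piGibbsLaw`, the normalised `p · ⊗Haar`). -/
theorem latSweep_uniformlyErgodic (hp : Measurable p) (hm0 : mlo ≠ 0) (hMtop : Mhi ≠ ∞)
    (hmp : ∀ ω, mlo ≤ p ω) (hpM : ∀ ω, p ω ≤ Mhi) (frames : List (n ≃ Fin 2 ⊕ m))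
    (hlex : frames.map pairOf = lexPairs (Finset.univ.sort (· ≤ ·) : List n) ∨
      frames.map pairOf = (lexPairs (Finset.univ.sort (· ≤ ·) : List n)).reverse)
    {links : List ι} (hl : ∀ l, l ∈ links) :
    ∃ ε : ℝ, 0 < ε ∧ ∀ (μ₀ : Measure (Cfg ι n)) [IsProbabilityMeasure μ₀] (t : ℕ) (A : Set (Cfg ι n)),
      |((fun ν : Measure (Cfg ι n) => ν.bind (latSweep p frames links))^[t] μ₀).real A
        - (piGibbsLaw (linkHaar ι n) p).real A| ≤ (1 - ε) ^ t := by
  obtain ⟨ε, hε, hmin⟩ := latSweep_minorised hp hm0 hMtop hmp hpM frames hlex hl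
  haveI := isMarkovKernel_latSweep hp hm0 hMtop hmp hpM frames links
  haveI := isProbabilityMeasure_piGibbsLaw (μ := linkHaar ι n) (p := p) hm0 hMtop hmp hpM
  have hε1 : ε ≤ 1 := by
    have h1 := Measure.le_iff'.1 (hmin 1) Set.univ
    rwa [Measure.smul_apply, smul_eq_mul, measure_univ, measure_univ, mul_one] at h1
  refine ⟨ε.toReal, ENNReal.toReal_pos hε (ne_top_of_le_ne_top ENNReal.one_ne_top hε1), fun μ₀ _ t A => ?_⟩
  exact uniformlyErgodic_of_minorised hmin (latSweep_invariant_piGibbsLaw hp hm0 hMtop hmp hpM frames links) μ₀ t A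

/-- **Uniqueness of the invariant law** of the sweep. -/
theorem latSweep_invariant_unique (hp : Measurable p) (hm0 : mlo ≠ 0) (hMtop : Mhi ≠ ∞)
    (hmp : ∀ ω, mlo ≤ p ω) (hpM : ∀ ω, p ω ≤ Mhi) (frames : List (n ≃ Fin 2 ⊕ m))
    (hlex : frames.map pairOf = lexPairs (Finset.univ.sort (· ≤ ·) : List n) ∨
      frames.map pairOf = (lexPairs (Finset.univ.sort (· ≤ ·) : List n)).reverse)
    {links : List ι} (hl : ∀ l, l ∈ links) (π' : Measure (Cfg ι n)) [IsProbabilityMeasure π']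
    (hπ' : Kernel.Invariant (latSweep p frames links) π') : π' = piGibbsLaw (linkHaar ι n) p := by
  obtain ⟨ε, hε, hmin⟩ := latSweep_minorised hp hm0 hMtop hmp hpM frames hlex hl
  haveI := isMarkovKernel_latSweep hp hm0 hMtop hmp hpM frames links
  haveI := isProbabilityMeasure_piGibbsLaw (μ := linkHaar ι n) (p := p) hm0 hMtop hmp hpM
  exact invariant_unique_of_minorised hmin (pos_iff_ne_zero.2 hε)
    (latSweep_invariant_piGibbsLaw hp hm0 hMtop hmp hpM frames links) hπ'

/-- **… and so is the composite sweep** "CM heat-bath sweep, then any exact Markov kernel" (the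
engine's interleaved over-relaxation sweeps, `CabibboMarinariOverrelax.lean`): `η ∘ₖ K` obeys the
same kind of bound, hence has the same unique invariant law. -/
theorem latSweep_comp_uniformlyErgodic (hp : Measurable p) (hm0 : mlo ≠ 0) (hMtop : Mhi ≠ ∞)
    (hmp : ∀ ω, mlo ≤ p ω) (hpM : ∀ ω, p ω ≤ Mhi) (frames : List (n ≃ Fin 2 ⊕ m))
    (hlex : frames.map pairOf = lexPairs (Finset.univ.sort (· ≤ ·) : List n) ∨
      frames.map pairOf = (lexPairs (Finset.univ.sort (· ≤ ·) : List n)).reverse)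
    {links : List ι} (hl : ∀ l, l ∈ links) (η : Kernel (Cfg ι n) (Cfg ι n)) [IsMarkovKernel η]
    (hη : Kernel.Invariant η ((Measure.pi (linkHaar ι n)).withDensity p)) :
    ∃ ε : ℝ, 0 < ε ∧ ∀ (μ₀ : Measure (Cfg ι n)) [IsProbabilityMeasure μ₀] (t : ℕ) (A : Set (Cfg ι n)),
      |((fun ν : Measure (Cfg ι n) => ν.bind (η ∘ₖ latSweep p frames links))^[t] μ₀).real A
        - (piGibbsLaw (linkHaar ι n) p).real A| ≤ (1 - ε) ^ t := by
  obtain ⟨ε, hε, hmin⟩ := latSweep_minorised hp hm0 hMtop hmp hpM frames hlex hl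
  haveI := isMarkovKernel_latSweep hp hm0 hMtop hmp hpM frames links
  haveI := isProbabilityMeasure_piGibbsLaw (μ := linkHaar ι n) (p := p) hm0 hMtop hmp hpM
  haveI : IsProbabilityMeasure ((Measure.pi (linkHaar ι n)).bind η) :=
    ⟨by rw [Measure.bind_apply MeasurableSet.univ (Kernel.aemeasurable _)]; simp⟩
  have hmin' := fun a => minorised_comp_left hmin η a
  have hinv : Kernel.Invariant (η ∘ₖ latSweep p frames links) (piGibbsLaw (linkHaar ι n) p) :=
    (invariant_smul hη _).comp (latSweep_invariant_piGibbsLaw hp hm0 hMtop hmp hpM frames links)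
  have hε1 : ε ≤ 1 := by
    have h1 := Measure.le_iff'.1 (hmin' 1) Set.univ
    rwa [Measure.smul_apply, smul_eq_mul, measure_univ, measure_univ, mul_one] at h1
  refine ⟨ε.toReal, ENNReal.toReal_pos hε (ne_top_of_le_ne_top ENNReal.one_ne_top hε1), fun μ₀ _ t A => ?_⟩
  exact uniformlyErgodic_of_minorised hmin' hinv μ₀ t A

/-! ## §3 Continuous actions; the Wilson theory with gauge group `SU(N)` -/

/-- **Continuous action on the compact configuration space**: the sweep for `p = e^{−S}` with `S`
continuous is uniformly ergodic (bounds by compactness). -/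
theorem latSweep_uniformlyErgodic_of_continuous {S : Cfg ι n → ℝ} (hS : Continuous S)
    (frames : List (n ≃ Fin 2 ⊕ m))
    (hlex : frames.map pairOf = lexPairs (Finset.univ.sort (· ≤ ·) : List n) ∨
      frames.map pairOf = (lexPairs (Finset.univ.sort (· ≤ ·) : List n)).reverse)
    {links : List ι} (hl : ∀ l, l ∈ links) :
    ∃ ε : ℝ, 0 < ε ∧ ∀ (μ₀ : Measure (Cfg ι n)) [IsProbabilityMeasure μ₀] (t : ℕ) (A : Set (Cfg ι n)),
      |((fun ν : Measure (Cfg ι n) => ν.bind (latSweep (gibbsDensity S) frames links))^[t] μ₀).real A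
        - (piGibbsLaw (linkHaar ι n) (gibbsDensity S)).real A| ≤ (1 - ε) ^ t := by
  obtain ⟨ωa, -, hmin⟩ := isCompact_univ.exists_isMinOn (Set.univ_nonempty (α := Cfg ι n)) hS.continuousOn
  obtain ⟨ωb, -, hmax⟩ := isCompact_univ.exists_isMaxOn (Set.univ_nonempty (α := Cfg ι n)) hS.continuousOn
  have hωa : ∀ ω, S ωa ≤ S ω := fun ω => (isMinOn_iff.1 hmin) ω (Set.mem_univ ω)
  have hωb : ∀ ω, S ω ≤ S ωb := fun ω => (isMaxOn_iff.1 hmax) ω (Set.mem_univ ω)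
  have hp : Measurable (gibbsDensity S) :=
    (Real.measurable_exp.comp hS.measurable.neg).ennreal_ofReal
  exact latSweep_uniformlyErgodic hp (by rw [Ne, ENNReal.ofReal_eq_zero, not_le]; exact Real.exp_pos _)
    ENNReal.ofReal_ne_top (fun ω => (gibbsDensity_bounds hωa hωb ω).1) (fun ω => (gibbsDensity_bounds hωa hωb ω).2)
    frames hlex hl

end Lattice

/-! ## §4 The engine instance: the torus Wilson theory with gauge group `SU(N)` -/

section Wilson

open Literature.MathematicalPhysics.QuantumFieldTheory

variable {d L N : ℕ} [Nonempty n] [LinearOrder n] {m : Type*} [Fintype m] [DecidableEq m]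
  (ρ : Matrix.specialUnitaryGroup n ℂ →* Matrix (Fin N) (Fin N) ℂ)

/-- **The SU(N) heat-bath sweep of `latflow.core` converges to the Wilson measure from every start.**
For the Literature torus Wilson theory with gauge group `SU(N)` (`N ≥ 2`, any continuous
representation `ρ`, any `d`, `L`, `β`): the sweep of Cabibbo–Marinari link updates (all coordinate
pairs lexicographically or reversed, every edge visited) satisfies, for some `ε > 0`,
`|μ₀Kᵗ(A) − μ_{Λ,β}(A)| ≤ (1 − ε)ᵗ` for every initial law, every `t`, every set; the Wilson measure
is its unique invariant law (`latSweep_invariant_unique`). -/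
theorem wilson_cmSweep_uniformlyErgodic [NeZero L] (hρ : Continuous ρ) (β : ℝ)
    (frames : List (n ≃ Fin 2 ⊕ m))
    (hlex : frames.map pairOf = lexPairs (Finset.univ.sort (· ≤ ·) : List n) ∨
      frames.map pairOf = (lexPairs (Finset.univ.sort (· ≤ ·) : List n)).reverse)
    {links : List (Edge d L)} (hl : ∀ e, e ∈ links) :
    ∃ ε : ℝ, 0 < ε ∧ ∀ (μ₀ : Measure (GaugeConfig d L (Matrix.specialUnitaryGroup n ℂ))) [IsProbabilityMeasure μ₀]
      (t : ℕ) (A : Set (GaugeConfig d L (Matrix.specialUnitaryGroup n ℂ))),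
      |((fun ν : Measure (GaugeConfig d L (Matrix.specialUnitaryGroup n ℂ)) =>
          ν.bind (latSweep (gibbsDensity fun U => β * wilsonAction ρ U) frames links))^[t] μ₀).real A
        - (wilsonMeasure ρ β).real A| ≤ (1 - ε) ^ t := by
  rw [wilsonMeasure_eq_piGibbsLaw]
  exact latSweep_uniformlyErgodic_of_continuous (continuous_smul_wilsonAction ρ hρ β) frames hlex hl

end Wilson

end Summit.Ventures.LatticeQCDFlow.Exactness
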